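import Summits.AtomisticToContinuum.FouriersLaw.Theorems.PuiseuxTransferLedgerTwoModeBulkCorrectorIdentityBond

/-!
# `TwoModeBulk` (route PuiseuxTransferLedger): time-integrated current–energy covariances are NOT local

Negative knowledge for crux `stmt-AtomisticToContinuum-12111` (`PuiseuxTransferLedger.TwoModeBulk`),
recorded by the redirect strategist r1 (STRATEGY-CENSUS.md Part r1, heading Strengthen).

By the corrector form of the crux (`twoModeBulk_iff_correctorTwoMode`, p163420) the missing input of
`TwoModeBulk` is `N`-uniform control of the increments of the time-integrated equilibrium covariances
`i ↦ ∫₀^∞ Cov_{μ₀}(J, K_s p_i²) ds` of the open chain at bath temperatures `(T, T)`.  The natural RIGID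
strengthening one would like to induct on — "space–time locality of influence": the integrated
covariance `W_m(i) := ∫₀^∞ Cov_{μ₀}(j_m, K_s p_i²) ds` of the current through bond `m` with the kinetic
temperature at site `i` decays in the distance `|i - m|`, uniformly in `N` — is FALSE, exactly and for
every parameter value, as a two-line corollary of the bond-resolved corrector identity
`pinnedChain_correctorIdentity_bond` (p162849): `γ ∫₀^∞ Y_i = T²·[i ≤ m] + W_m(i)` for EVERY bond `m`, hence

* `integratedCov_bond_sub`: `W_m(i) - W_{m'}(i) = T² ([i ≤ m'] - [i ≤ m])` for any two bonds;
* `integratedCov_jump`: for bonds `m < i ≤ m'` (however far from `i`): `W_m(i) - W_{m'}(i) = T²`;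
* `twoModeBulk_integratedNonlocality` (registered sub-goal of the crux item): consequently
  `max(|W_m(i)|, |W_{m'}(i)|) ≥ T²/2` — taking `i = N/2`, `m = 0`, `m' = N - 1`, at least one bond at
  distance `≥ N/2 - 1` from `i` has integrated covariance `≥ T²/2`, for every `N`.

Reading: a current fluctuation through bond `m` moves energy from the block `≤ m` to the block `> m`;
in the open chain this imbalance relaxes only diffusively through the baths, and its time integral is
felt with weight `O(T²)` at every site.  Any locality-based attack on the crux must therefore be
TIME-RESOLVED (finite-time light cone) AND must show that the diffusive tail contributes to the
increments `W(i+1) - W(i)` only the exact Ohmic slope up to exponentially localised corrections — i.e.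
`N`-uniform control of the non-hydrodynamic part of the open chain's relaxation, which is the content of
the crux itself (census Part r1).  [folklore]
-/

noncomputable section

open scoped NNReal ENNReal Topology
open MeasureTheory Filter Set

namespace Summit.AtomisticToContinuum.FouriersLaw.Theorems

namespace TwoModeBulkPlacement

open Literature.MathematicalPhysics.KineticTheory.HeatConduction
open Summit.AtomisticToContinuum.FouriersLaw.Theorems.TwoModeBulk.Sketch (pinnedChain_correctorIdentity_bond)

/-- **Bond-independence defect of the integrated current–kinetic covariance.** For any two genuine bonds
`m, m' < N` and any site `i`: `W_m(i) - W_{m'}(i) = T² ([i ≤ m'] - [i ≤ m])`. [folklore] -/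
theorem integratedCov_bond_sub {ω₂ lam β γ : ℝ} (hω : 0 < ω₂) (hl : 0 ≤ lam) (hβ : 0 < β) (hγ : 0 < γ)
    (N : ℕ) {T : ℝ} (hT : 0 < T) (i m m' : Fin (N + 1)) (hm : m.val < N) (hm' : m'.val < N) :
    (∫ s in Set.Ioi (0 : ℝ), ((∫ z, (Literature.MathematicalPhysics.KineticTheory.HeatConduction.pinnedChain ω₂ lam β γ).bondCurrent (N + 1) m z * (∫ y, (y.2 i) ^ 2 ∂((Literature.MathematicalPhysics.KineticTheory.HeatConduction.pinnedChain ω₂ lam β γ).transitionKernel (N + 1) T T s.toNNReal z)) ∂((Literature.MathematicalPhysics.KineticTheory.HeatConduction.pinnedChain ω₂ lam β γ).gibbsMeasure (N + 1) T)) - (∫ z, (Literature.MathematicalPhysics.KineticTheory.HeatConduction.pinnedChain ω₂ lam β γ).bondCurrent (N + 1) m z ∂((Literature.MathematicalPhysics.KineticTheory.HeatConduction.pinnedChain ω₂ lam β γ).gibbsMeasure (N + 1) T)) * (∫ z, (∫ y, (y.2 i) ^ 2 ∂((Literature.MathematicalPhysics.KineticTheory.HeatConduction.pinnedChain ω₂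 lam β γ).transitionKernel (N + 1) T T s.toNNReal z)) ∂((Literature.MathematicalPhysics.KineticTheory.HeatConduction.pinnedChain ω₂ lam β γ).gibbsMeasure (N + 1) T)))) - (∫ s in Set.Ioi (0 : ℝ), ((∫ z, (Literature.MathematicalPhysics.KineticTheory.HeatConduction.pinnedChain ω₂ lam β γ).bondCurrent (N + 1) m' z * (∫ y, (y.2 i) ^ 2 ∂((Literature.MathematicalPhysics.KineticTheory.HeatConduction.pinnedChain ω₂ lam β γ).transitionKernel (N + 1) T T s.toNNReal z)) ∂((Literature.MathematicalPhysics.KineticTheory.HeatConduction.pinnedChain ω₂ lam β γ).gibbsMeasure (N + 1) T)) - (∫ z, (Literature.MathematicalPhysics.KineticTheory.HeatConduction.pinnedChain ω₂ lam β γ).bondCurrent (N + 1) m' z ∂((Literature.MathematicalPhysics.KineticTheory.HeatConduction.pinnedChain ω₂ lam β γ).gibbsMeasure (N + 1) T)) * (∫ z, (∫ y, (y.2 i) ^ 2 ∂((Literature.MathematicalPhysics.KineticTheory.HeatConduction.pinnedChain ω₂ lam β γ).transitionKernel (N + 1) T T s.toNNReal z)) ∂((Literature.MathematicalPhysics.KineticTheory.HeatConduction.pinnedChain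 ω₂ lam β γ).gibbsMeasure (N + 1) T)))) =
      T ^ 2 * ((if i.val ≤ m'.val then 1 else 0) - (if i.val ≤ m.val then 1 else 0)) := by
  have h1 := (pinnedChain_correctorIdentity_bond hω hl hβ hγ N hT i m hm).2
  have h2 := (pinnedChain_correctorIdentity_bond hω hl hβ hγ N hT i m' hm').2
  linarith

/-- **The jump.** For bonds `m < i ≤ m'` the two integrated covariances differ by exactly `T²`,
however far `m` and `m'` are from `i`. [folklore] -/
theorem integratedCov_jump {ω₂ lam β γ : ℝ} (hω : 0 < ω₂) (hl : 0 ≤ lam) (hβ : 0 < β) (hγ : 0 < γ)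
    (N : ℕ) {T : ℝ} (hT : 0 < T) (i m m' : Fin (N + 1)) (hmi : m.val < i.val) (him' : i.val ≤ m'.val)
    (hm' : m'.val < N) :
    (∫ s in Set.Ioi (0 : ℝ), ((∫ z, (Literature.MathematicalPhysics.KineticTheory.HeatConduction.pinnedChain ω₂ lam β γ).bondCurrent (N + 1) m z * (∫ y, (y.2 i) ^ 2 ∂((Literature.MathematicalPhysics.KineticTheory.HeatConduction.pinnedChain ω₂ lam β γ).transitionKernel (N + 1) T T s.toNNReal z)) ∂((Literature.MathematicalPhysics.KineticTheory.HeatConduction.pinnedChain ω₂ lam β γ).gibbsMeasure (N + 1) T)) - (∫ z, (Literature.MathematicalPhysics.KineticTheory.HeatConduction.pinnedChain ω₂ lam β γ).bondCurrent (N + 1) m z ∂((Literature.MathematicalPhysics.KineticTheory.HeatConduction.pinnedChain ω₂ lam β γ).gibbsMeasure (N + 1) T)) * (∫ z, (∫ y, (y.2 i) ^ 2 ∂((Literature.MathematicalPhysics.KineticTheory.HeatConduction.pinnedChain ω₂ lam β γ).transitionKernel (N + 1) T T s.toNNReal z)) ∂((Literature.MathematicalPhysics.KineticTheory.HeatConduction.pinnedChain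 ω₂ lam β γ).gibbsMeasure (N + 1) T)))) - (∫ s in Set.Ioi (0 : ℝ), ((∫ z, (Literature.MathematicalPhysics.KineticTheory.HeatConduction.pinnedChain ω₂ lam β γ).bondCurrent (N + 1) m' z * (∫ y, (y.2 i) ^ 2 ∂((Literature.MathematicalPhysics.KineticTheory.HeatConduction.pinnedChain ω₂ lam β γ).transitionKernel (N + 1) T T s.toNNReal z)) ∂((Literature.MathematicalPhysics.KineticTheory.HeatConduction.pinnedChain ω₂ lam β γ).gibbsMeasure (N + 1) T)) - (∫ z, (Literature.MathematicalPhysics.KineticTheory.HeatConduction.pinnedChain ω₂ lam β γ).bondCurrent (N + 1) m' z ∂((Literature.MathematicalPhysics.KineticTheory.HeatConduction.pinnedChain ω₂ lam β γ).gibbsMeasure (N + 1) T)) * (∫ z, (∫ y, (y.2 i) ^ 2 ∂((Literature.MathematicalPhysics.KineticTheory.HeatConduction.pinnedChain ω₂ lam β γ).transitionKernel (N + 1) T T s.toNNReal z)) ∂((Literature.MathematicalPhysics.KineticTheory.HeatConduction.pinnedChain ω₂ lam β γ).gibbsMeasure (N + 1) T)))) = T ^ 2 := by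
  have hm : m.val < N := lt_of_lt_of_le hmi (le_trans him' hm'.le)
  have h := integratedCov_bond_sub hω hl hβ hγ N hT i m m' hm hm'
  rw [if_pos him', if_neg (not_le.mpr hmi)] at h
  linarith

/-- From a jump of size `T²` between two reals, one of them has modulus `≥ T²/2`. -/
theorem half_sq_le_max_abs_of_sub_eq {a b T : ℝ} (h : a - b = T ^ 2) : T ^ 2 / 2 ≤ max |a| |b| := by
  have hab : |a - b| ≤ |a| + |b| := abs_sub a b
  have hT2 : |a - b| = T ^ 2 := by rw [h, abs_of_nonneg (sq_nonneg T)]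
  rcases le_total |a| |b| with hle | hle
  · exact le_trans (by linarith) (le_max_right _ _)
  · exact le_trans (by linarith) (le_max_left _ _)

end TwoModeBulkPlacement

/-- **Registered sub-goal `twoModeBulk_integratedNonlocality`** of crux stmt-AtomisticToContinuum-12111
(redirect strategist r1; negative knowledge): the time-integrated equilibrium covariance of a bond current
with a site kinetic temperature jumps by exactly `T²` between bonds left and right of the site, so it is
`≥ T²/2` in modulus at one of any two such bonds — integrated space–time locality of influence fails
uniformly in `N`. [folklore] -/
theorem twoModeBulk_integratedNonlocality : ∀ ω₂ lam β γ : ℝ, 0 < ω₂ → 0 < lam → 0 < β → 0 < γ → ∀ (N : ℕ) (T : ℝ), 0 < T → ∀ i m m' : Fin (N + 1), m.val < i.val → i.val ≤ m'.val → m'.val < N → (∫ s in Set.Ioi (0 : ℝ), ((∫ z, (Literature.MathematicalPhysics.KineticTheory.HeatConduction.pinnedChain ω₂ lam β γ).bondCurrent (N + 1) m z * (∫ y, (y.2 i) ^ 2 ∂((Literature.MathematicalPhysics.KineticTheory.HeatConduction.pinnedChain ω₂ lam β γ).transitionKernel (N + 1) T T s.toNNReal z)) ∂((Literature.MathematicalPhysics.KineticTheory.HeatConduction.pinnedChain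 ω₂ lam β γ).gibbsMeasure (N + 1) T)) - (∫ z, (Literature.MathematicalPhysics.KineticTheory.HeatConduction.pinnedChain ω₂ lam β γ).bondCurrent (N + 1) m z ∂((Literature.MathematicalPhysics.KineticTheory.HeatConduction.pinnedChain ω₂ lam β γ).gibbsMeasure (N + 1) T)) * (∫ z, (∫ y, (y.2 i) ^ 2 ∂((Literature.MathematicalPhysics.KineticTheory.HeatConduction.pinnedChain ω₂ lam β γ).transitionKernel (N + 1) T T s.toNNReal z)) ∂((Literature.MathematicalPhysics.KineticTheory.HeatConduction.pinnedChain ω₂ lam β γ).gibbsMeasure (N + 1) T)))) - (∫ s in Set.Ioi (0 : ℝ), ((∫ z, (Literature.MathematicalPhysics.KineticTheory.HeatConduction.pinnedChain ω₂ lam β γ).bondCurrent (N + 1) m' z * (∫ y, (y.2 i) ^ 2 ∂((Literature.MathematicalPhysics.KineticTheory.HeatConduction.pinnedChain ω₂ lam β γ).transitionKernel (N + 1) T T s.toNNReal z)) ∂((Literature.MathematicalPhysics.KineticTheory.HeatConduction.pinnedChain ω₂ lam β γ).gibbsMeasure (N + 1) T)) - (∫ z, (Literature.MathematicalPhysics.KineticTheory.HeatConduction.pinnedChain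 ω₂ lam β γ).bondCurrent (N + 1) m' z ∂((Literature.MathematicalPhysics.KineticTheory.HeatConduction.pinnedChain ω₂ lam β γ).gibbsMeasure (N + 1) T)) * (∫ z, (∫ y, (y.2 i) ^ 2 ∂((Literature.MathematicalPhysics.KineticTheory.HeatConduction.pinnedChain ω₂ lam β γ).transitionKernel (N + 1) T T s.toNNReal z)) ∂((Literature.MathematicalPhysics.KineticTheory.HeatConduction.pinnedChain ω₂ lam β γ).gibbsMeasure (N + 1) T)))) = T ^ 2 ∧ T ^ 2 / 2 ≤ max |(∫ s in Set.Ioi (0 : ℝ), ((∫ z, (Literature.MathematicalPhysics.KineticTheory.HeatConduction.pinnedChain ω₂ lam β γ).bondCurrent (N + 1) m z * (∫ y, (y.2 i) ^ 2 ∂((Literature.MathematicalPhysics.KineticTheory.HeatConduction.pinnedChain ω₂ lam β γ).transitionKernel (N + 1) T T s.toNNReal z)) ∂((Literature.MathematicalPhysics.KineticTheory.HeatConduction.pinnedChain ω₂ lam β γ).gibbsMeasure (N + 1) T)) - (∫ z, (Literature.MathematicalPhysics.KineticTheory.HeatConduction.pinnedChain ω₂ lam β γ).bondCurrent (N + 1)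 m z ∂((Literature.MathematicalPhysics.KineticTheory.HeatConduction.pinnedChain ω₂ lam β γ).gibbsMeasure (N + 1) T)) * (∫ z, (∫ y, (y.2 i) ^ 2 ∂((Literature.MathematicalPhysics.KineticTheory.HeatConduction.pinnedChain ω₂ lam β γ).transitionKernel (N + 1) T T s.toNNReal z)) ∂((Literature.MathematicalPhysics.KineticTheory.HeatConduction.pinnedChain ω₂ lam β γ).gibbsMeasure (N + 1) T))))| |(∫ s in Set.Ioi (0 : ℝ), ((∫ z, (Literature.MathematicalPhysics.KineticTheory.HeatConduction.pinnedChain ω₂ lam β γ).bondCurrent (N + 1) m' z * (∫ y, (y.2 i) ^ 2 ∂((Literature.MathematicalPhysics.KineticTheory.HeatConduction.pinnedChain ω₂ lam β γ).transitionKernel (N + 1) T T s.toNNReal z)) ∂((Literature.MathematicalPhysics.KineticTheory.HeatConduction.pinnedChain ω₂ lam β γ).gibbsMeasure (N + 1) T)) - (∫ z, (Literature.MathematicalPhysics.KineticTheory.HeatConduction.pinnedChain ω₂ lam β γ).bondCurrent (N + 1) m' z ∂((Literature.MathematicalPhysics.KineticTheory.HeatConduction.pinnedChain ω₂ lam β γ).gibbsMeasure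 (N + 1) T)) * (∫ z, (∫ y, (y.2 i) ^ 2 ∂((Literature.MathematicalPhysics.KineticTheory.HeatConduction.pinnedChain ω₂ lam β γ).transitionKernel (N + 1) T T s.toNNReal z)) ∂((Literature.MathematicalPhysics.KineticTheory.HeatConduction.pinnedChain ω₂ lam β γ).gibbsMeasure (N + 1) T))))| := by
  intro ω₂ lam β γ hω hl hβ hγ N T hT i m m' hmi him' hm'
  have h := TwoModeBulkPlacement.integratedCov_jump hω hl.le hβ hγ N hT i m m' hmi him' hm'
  exact ⟨h, TwoModeBulkPlacement.half_sq_le_max_abs_of_sub_eq h⟩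

end Summit.AtomisticToContinuum.FouriersLaw.Theorems
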